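import Summits.Ventures.PackingBounds.ThreePointCert.K5Cert

/-!
# κ(5) ≤ 45 (three-point bound, kernel-checked): kernel validation of Gram block R4 (chunks 1–3 of 3)

Framing: lottery ticket; floor = certified bounds/negative ranges. Venture `PackingBounds` (cell
`pub-packcert`), three-point SDP family. Integer data of a feasible point of the Bachoc–Vallentin
semidefinite program (n = 5, s = 1/2, degree d = 8, symmetric
sums of squares), derived by `pub-packcert-sdp/code/cert2lean.py` from the exact rational
certificate `sdp-n5-d8-s1-2-sym.json` of the cell (two independent exact verifiers + referee), in the
units of the kernel checker `ThreePointCert.Check` (soundness `ThreePointCert.Sound`). Generated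
file: plain lists of integers / monomials.
-/

namespace Summit.Ventures.PackingBounds.ThreePointCert.K5

open Literature.Geometry.DiscreteGeometry Literature.Geometry.DiscreteGeometry.PolyCert PolyCert.SPoly

set_option maxHeartbeats 0 in
/-- Block `R4`: rows from 0 (54 rows) of `zᵀ(LLᵀ)z` added to `[]` give `dR4c1` (kernel). -/
theorem okR4_1 : chunkOK gR4 0 54 [] dR4c1 = true := by
  decide +kernel

set_option maxHeartbeats 0 in
/-- Block `R4`: rows from 54 (29 rows) of `zᵀ(LLᵀ)z` added to `dR4c1` give `dR4c2` (kernel). -/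
theorem okR4_2 : chunkOK gR4 54 29 dR4c1 dR4c2 = true := by
  decide +kernel

set_option maxHeartbeats 0 in
/-- Block `R4`: rows from 83 ((gR4.z.length - 83) rows) of `zᵀ(LLᵀ)z` added to `dR4c2` give `eR4` (kernel). -/
theorem okR4_3 : chunkOK gR4 83 (gR4.z.length - 83) dR4c2 eR4 = true := by
  decide +kernel

end Summit.Ventures.PackingBounds.ThreePointCert.K5
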